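import Literature.AlgebraicGeometry.FundamentalGroup.ProjectiveSpaceProofs
import Literature.AlgebraicGeometry.Motives.ProjectiveSpaceFunctionField
import Literature.AlgebraicGeometry.Motives.FunctionFieldOver
import Literature.AlgebraicGeometry.Motives.GoodReductionSpecialFibreProofs
import Literature.AlgebraicGeometry.Resolution.FiniteBirationalNormal
import Literature.AlgebraicGeometry.Resolution.SmoothStalksRegular
import Literature.AlgebraicGeometry.Resolution.SmoothOverNormal
import Literature.NumberTheory.DiophantineGeometry.FunctionFieldUnramifiedCharts
import Literature.NumberTheory.DiophantineGeometry.FunctionFieldPointCountRationalProofs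
import Literature.NumberTheory.DiophantineGeometry.FunctionFieldSchmidtDegreeOneExtensionProofs
import Mathlib.AlgebraicGeometry.Morphisms.Etale
import Mathlib.RingTheory.Unramified.Field
import Mathlib.RingTheory.Polynomial.Ideal
import HarnessLib

/-!
# `ℙ¹` over an algebraically closed field is simply connected (SGA 1, XI 1.1, `r = 1`) — discharge

Topic: `Literature/AlgebraicGeometry/FundamentalGroup`. Proof of the named fact
`Literature.AlgebraicGeometry.FundamentalGroup.ProjectiveLineSimplyConnected`
(`FundamentalGroup/ProjectiveSpace.lean`): every finite étale `π : Y → ℙ¹_k` with `Y` connected,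
`k` algebraically closed, is an isomorphism — by the printed argument of SGA 1, Exp. XI, Prop. 1.1
("la formule du genre nous donne `1 - g' = d(1 - g)` […] ce qui exige `d = 1`"), run through the
tree's theory of algebraic function fields of one variable:

1. `Y` is smooth over `k`, hence reduced with integral local rings, and connected, hence integral
   (`Resolution.isDomain_stalk_of_smooth`, `Motives.irreducibleSpace_of_isDomain_stalk`); `π` is
   surjective (`surjective_of_isFinite_of_etale_projectiveSpace`), so `F = K(Y)` is a finite
   extension of `K(ℙ¹) = k(t)`, `t = x₁/x₀` (`Motives.FunctionFieldOver`), an algebraic function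
   field over `k` (`isAlgFunctionField_functionField_P1`).
2. Over the two standard charts `D₊(x₀) = Spec k[t]`, `D₊(x₁) = Spec k[t⁻¹]` the coordinate rings
   `Bᵢ = Γ(π⁻¹ D₊(xᵢ), 𝒪_Y)` are finite étale over `k[t^{±1}]`; in `F` they contain `t` resp.
   `t⁻¹`, lie in every valuation ring `𝒪_P ∋ t` resp. `∋ t⁻¹` (integrality), have fraction field
   `F`, and their fibre rings `B₀/(t - c)`, `B₁/(t⁻¹)` are reduced (`Algebra.FormallyUnramified.
   isRadical_map_isMaximal`) and Artinian (finite over `k`).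
3. Hence every place of `F/k` is unramified over `k(t)` and `F = k(t)` by the Riemann–Hurwitz
   count (`AlgFunctionField.adjoin_simple_eq_top_of_charts`, files
   `NumberTheory/DiophantineGeometry/FunctionFieldHurwitzTame`, `…UnramifiedCharts`): `π` is
   birational, finite, onto the normal `ℙ¹`, so an isomorphism
   (`Resolution.isIso_morphismRestrict_of_isIntegralHom_of_isIso_stalkMap`).

Everything is proved; no named facts are introduced.

## References

* A. Grothendieck, M. Raynaud, SGA 1 (LNM 224 / SMF 2003), Exp. XI Prop. 1.1; Exp. I Déf. 4.9,
  Cor. 9.11. [SGA1]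
* H. Stichtenoth, *Algebraic Function Fields and Codes*, GTM 254 (2009), Thm. 3.4.13, Thm. 3.5.1.
  [Stichtenoth2009]
-/

noncomputable section

open CategoryTheory CategoryTheory.Limits AlgebraicGeometry TopologicalSpace Opposite
open HomogeneousLocalization MvPolynomial
open Literature.AlgebraicGeometry.Motives Literature.AlgebraicGeometry.Motives.Segre
open Literature.AlgebraicGeometry.Motives.RatFn Literature.AlgebraicGeometry.Motives.ProjSpace
open Literature.NumberTheory.DiophantineGeometry
open Literature.NumberTheory.DiophantineGeometry.AlgFunctionField
open scoped IntermediateField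

attribute [local instance] MvPolynomial.gradedAlgebra
  Literature.AlgebraicGeometry.Motives.ProjBaseChange.algebraBase

namespace Literature.AlgebraicGeometry.FundamentalGroup

universe u

variable (K : Type u) [Field K]

/-! ### The function field of `ℙ¹`: the coordinate `t = x₁/x₀` -/

/-- The polynomial chart `K[X] ≅ (K[x₀,x₁]_{(x_l)})₀`, `X ↦ x_{l'}/x_l` (dehomogenisation,
`ProjectiveSpace.chartAlgEquiv`, composed with `K[X] ≅ K[y₀]`); a notation, not a declaration. -/
local notation "polyChart[" K' ", " l' "]" =>
  (AlgEquiv.trans (AlgEquiv.symm (MvPolynomial.uniqueAlgEquiv K' (Fin 1)))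
    (AlgEquiv.symm (ProjectiveSpace.chartAlgEquiv K' l')))

namespace P1

/-- In `K(ℙ¹)`: `(x₁/x₀) · (x₀/x₁) = 1`. [folklore] -/
theorem coord_mul_coord_eq_one :
    awayToFunctionField (d := 1) (K := K) 0 (frac K 0 1) * awayToFunctionField 1 (frac K 1 0) = 1 := by
  obtain ⟨ρ, -, h0, h1⟩ := exists_awayToFunctionField_eq_comp_awayMap (d := 1) (K := K) 0 1
  rw [h0, h1, RingHom.comp_apply, RingHom.comp_apply, ← map_mul, awayMap_frac_mul_awayMap_frac,
    map_one]

/-- The constants of the chart algebra: Mathlib's `algebraMap K (K[x]_{(x_l)})₀` is `Segre.cst`.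
[folklore] -/
theorem algebraMap_away_eq_cst (l : Fin 2) (c : K) :
    algebraMap K (Away (grading (Fin 2) K) (X l)) c = cst K (X l) c := by
  apply val_injective
  rw [ProjBaseChange.val_algebraMap, val_cst]
  rfl

/-- The chart generator of `chartAlgEquiv` is the coordinate ratio: `chartGen K l 0 = x_{l'}/x_l`
(`l' = l.succAbove 0`). [folklore] -/
theorem chartGen_eq_frac (l : Fin 2) :
    ProjectiveSpace.chartGen K l 0 = frac K l (l.succAbove 0) := by
  apply val_injective
  rw [ProjectiveSpace.val_chartGen, val_frac]
  simp only [pow_one]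

/-- `polyChart l X = x_{l'}/x_l`. [folklore] -/
theorem polyChart_X (l : Fin 2) : polyChart[K, l] Polynomial.X = frac K l (l.succAbove 0) := by
  rw [AlgEquiv.trans_apply]
  rw [show (MvPolynomial.uniqueAlgEquiv K (Fin 1)).symm Polynomial.X = MvPolynomial.X 0 by
    simp [MvPolynomial.uniqueAlgEquiv], ProjectiveSpace.chartAlgEquiv_symm_X, chartGen_eq_frac]

/-- `polyChart l (C c) = c`. [folklore] -/
theorem polyChart_C (l : Fin 2) (c : K) :
    polyChart[K, l] (Polynomial.C c) = algebraMap K _ c := by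
  rw [← Polynomial.algebraMap_eq (R := K), AlgEquiv.commutes]

/-- **The chart map on polynomials is evaluation at the coordinate**: for `q ∈ K[X]`,
`awayToFunctionField l (polyChart l q) = q(x_{l'}/x_l)` in `K(ℙ¹)`. [folklore] -/
theorem awayToFunctionField_polyChart (l : Fin 2) (q : Polynomial K) :
    awayToFunctionField (d := 1) (K := K) l (polyChart[K, l] q) =
      Polynomial.eval₂ (algebraMap K (P 1 K).functionField)
        (awayToFunctionField (d := 1) (K := K) l (frac K l (l.succAbove 0))) q := by
  have key : ((awayToFunctionField (d := 1) (K := K) l).comp (polyChart[K, l]).toRingEquiv.toRingHom) =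
      Polynomial.eval₂RingHom (algebraMap K (P 1 K).functionField)
        (awayToFunctionField (d := 1) (K := K) l (frac K l (l.succAbove 0))) := by
    apply Polynomial.ringHom_ext
    · intro c
      rw [Polynomial.coe_eval₂RingHom, Polynomial.eval₂_C]
      change awayToFunctionField l (polyChart[K, l] (Polynomial.C c)) = _
      rw [polyChart_C, algebraMap_away_eq_cst, awayToFunctionField_cst]
    · rw [Polynomial.coe_eval₂RingHom, Polynomial.eval₂_X]
      change awayToFunctionField l (polyChart[K, l] Polynomial.X) = _
      rw [polyChart_X]
  exact congrArg (fun φ : Polynomial K →+* (P 1 K).functionField ↦ φ q) key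

/-- The coordinate `x_{l'}/x_l` is transcendental over `K` in `K(ℙ¹)`. [folklore] -/
theorem transcendental_coord (l : Fin 2) :
    Transcendental K (awayToFunctionField (d := 1) (K := K) l (frac K l (l.succAbove 0))) := by
  rw [transcendental_iff_injective]
  intro p q hpq
  have h : awayToFunctionField (d := 1) (K := K) l (polyChart[K, l] p) =
      awayToFunctionField (d := 1) (K := K) l (polyChart[K, l] q) := by
    rw [awayToFunctionField_polyChart, awayToFunctionField_polyChart]
    simpa only [Polynomial.aeval_def] using hpq
  exact (polyChart[K, l]).injective (awayToFunctionField_injective l h)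

/-- Every section of `𝒪_{ℙ¹}` over `D₊(x_l)` is a polynomial in `x_{l'}/x_l`:
`Γ(D₊(x_l), 𝒪) = K[x_{l'}/x_l]` (`sec_bijective` and the polynomial chart). [folklore] -/
theorem exists_sec_polyChart_eq (l : Fin 2) (a : Γ(P 1 K, U l)) :
    ∃ q : Polynomial K, sec l (polyChart[K, l] q) = a := by
  obtain ⟨α, rfl⟩ := (sec_bijective (d := 1) (K := K) l).2 a
  exact ⟨(polyChart[K, l]).symm α, by rw [AlgEquiv.apply_symm_apply]⟩

/-- **`K(ℙ¹) = K(t)`**, `t = x₁/x₀`: the function field of `ℙ¹_K` is generated by the coordinate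
(`K(ℙ¹) = Frac Γ(D₊(x₀), 𝒪) = Frac K[t]`). [folklore] -/
theorem adjoin_coord_eq_top :
    K⟮awayToFunctionField (d := 1) (K := K) 0 (frac K 0 1)⟯ = ⊤ := by
  set τ := awayToFunctionField (d := 1) (K := K) 0 (frac K 0 1) with hτ
  haveI : Nonempty (U (d := 1) (K := K) 0) := ⟨⟨_, genericPoint_mem_U 0⟩⟩
  have hUaff : IsAffineOpen (U (d := 1) (K := K) 0) := by
    have e : U (d := 1) (K := K) 0 = Proj.basicOpen (grading (Fin 2) K) (X 0) := Opens.ext (coe_U 0)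
    rw [e]
    exact Proj.isAffineOpen_basicOpen _ _ (X_mem K 0) zero_lt_one
  haveI := functionField_isFractionRing_of_isAffineOpen (X := P 1 K) (U 0) hUaff
  -- sections over `D₊(x₀)` are polynomials in `τ`
  have hsec : ∀ a : Γ(P 1 K, U 0), algebraMap Γ(P 1 K, U 0) (P 1 K).functionField a ∈ K⟮τ⟯ := by
    intro a
    obtain ⟨q, rfl⟩ := exists_sec_polyChart_eq K 0 a
    have : algebraMap Γ(P 1 K, U 0) (P 1 K).functionField (sec 0 (polyChart[K, 0] q)) =
        awayToFunctionField (d := 1) (K := K) 0 (polyChart[K, 0] q) := rfl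
    rw [this, awayToFunctionField_polyChart, Polynomial.eval₂_eq_sum_range]
    refine Finset.sum_induction _ (· ∈ K⟮τ⟯) (fun _ _ ↦ add_mem) (zero_mem _) fun i _ ↦ ?_
    exact mul_mem (algebraMap_mem _ _) (pow_mem (IntermediateField.mem_adjoin_simple_self K τ) i)
  rw [eq_top_iff]
  rintro h -
  obtain ⟨a, b, -, rfl⟩ := IsFractionRing.div_surjective (A := Γ(P 1 K, U 0)) h
  exact div_mem (hsec a) (hsec b)

/-- **`K(ℙ¹)/K` is an algebraic function field of one variable** (the rational function field
`K(t)`, Stichtenoth §1.2). [cite: Stichtenoth2009, §1.2] -/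
theorem isAlgFunctionField : IsAlgFunctionField K (P 1 K).functionField := by
  set τ := awayToFunctionField (d := 1) (K := K) 0 (frac K 0 1)
  haveI h1 : IsAlgFunctionField K K⟮τ⟯ := isAlgFunctionField_adjoin_simple (transcendental_coord K 0)
  exact IsAlgFunctionField.of_algEquiv
    ((IntermediateField.equivOfEq (adjoin_coord_eq_top K)).trans IntermediateField.topEquiv)

/-- The local rings of `ℙ¹_K` are integrally closed (`ℙ¹_K` is smooth over `K`, and smooth over
a normal base is normal, `Resolution.isIntegrallyClosed_stalk_of_mem_smoothLocus`). [folklore] -/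
theorem isIntegrallyClosed_stalk (y : P 1 K) : IsIntegrallyClosed ((P 1 K).presheaf.stalk y) := by
  haveI : SmoothOfRelativeDimension 1 (P 1 K ↘ Spec (.of K)) :=
    ProjectiveSpace.smoothOfRelativeDimension_projToSpec 1 K
  haveI : Smooth (P 1 K ↘ Spec (.of K)) := SmoothOfRelativeDimension.smooth 1 _
  haveI : Surjective (P 1 K ↘ Spec (.of K)) :=
    ⟨fun s ↦ ⟨ProjSpace.zeroPt, Subsingleton.elim _ _⟩⟩
  have hS : ∀ s : Spec (.of K), IsIntegrallyClosed ((Spec (.of K)).presheaf.stalk s) :=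
    isIntegrallyClosed_stalk_Spec (.of K)
  have hy : y ∈ (P 1 K ↘ Spec (.of K)).smoothLocus := by
    rw [Scheme.Hom.smoothLocus_eq_top]
    trivial
  exact Resolution.isIntegrallyClosed_stalk_of_mem_smoothLocus _ hS hy

end P1

/-! ### Two algebra lemmas -/

/-- `(X - c) ⊂ K[X]` is a maximal ideal (the kernel of evaluation at `c`). [folklore] -/
theorem isMaximal_span_X_sub_C (c : K) : (Ideal.span {Polynomial.X - Polynomial.C c} :
    Ideal (Polynomial K)).IsMaximal := by
  rw [← Polynomial.ker_evalRingHom]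
  exact RingHom.ker_isMaximal_of_surjective _ fun x ↦ ⟨Polynomial.C x, Polynomial.eval_C⟩

/-- **The fibre of a finite unramified algebra over a maximal ideal is reduced and Artinian**:
for `B` finite and formally unramified over `A` and `𝔭 ⊂ A` maximal, `B/𝔭B` is reduced
(Mathlib `Algebra.FormallyUnramified.isRadical_map_isMaximal`) and Artinian (finite over the
field `A/𝔭`). [folklore] -/
theorem isReduced_and_isArtinianRing_fibre {A B : Type*} [CommRing A] [CommRing B] [Algebra A B]
    [Module.Finite A B] [Algebra.FormallyUnramified A B] (p : Ideal A) [p.IsMaximal] :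
    IsReduced (B ⧸ p.map (algebraMap A B)) ∧ IsArtinianRing (B ⧸ p.map (algebraMap A B)) := by
  refine ⟨(Ideal.isRadical_iff_quotient_reduced _).1
    (Algebra.FormallyUnramified.isRadical_map_isMaximal A B p), ?_⟩
  letI := Ideal.Quotient.field p
  haveI : Module.Finite (A ⧸ p) (B ⧸ p.map (algebraMap A B)) :=
    Module.Finite.of_restrictScalars_finite A _ _
  exact IsArtinianRing.of_finite (A ⧸ p) _

/-! ### The cover -/

section Cover

variable {K}
variable {Y : Scheme.{u}} (π : Y ⟶ P 1 K) [Etale π]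

include π in
/-- A scheme étale over `ℙ¹_K` and connected is integral: it is smooth over `K`, so reduced
with integral local rings (`Resolution.isReduced_of_smooth`, `Resolution.isDomain_stalk_of_smooth`),
and a connected locally Noetherian scheme with integral local rings is irreducible
(`Motives.irreducibleSpace_of_isDomain_stalk`). [cite: SGA1, Exp. I Cor. 9.11] -/
theorem isIntegral_of_connectedSpace [ConnectedSpace Y] : IsIntegral Y := by
  haveI : SmoothOfRelativeDimension 1 (P 1 K ↘ Spec (.of K)) :=
    ProjectiveSpace.smoothOfRelativeDimension_projToSpec 1 K
  haveI : Smooth (P 1 K ↘ Spec (.of K)) := SmoothOfRelativeDimension.smooth 1 _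
  set f : Y ⟶ Spec (.of K) := π ≫ (P 1 K ↘ Spec (.of K)) with hf
  haveI : Smooth f := inferInstance
  haveI : IsReduced Y := Resolution.isReduced_of_smooth f
  haveI : IsLocallyNoetherian Y := LocallyOfFiniteType.isLocallyNoetherian f
  haveI : IrreducibleSpace Y :=
    irreducibleSpace_of_isDomain_stalk Y fun x ↦ Resolution.isDomain_stalk_of_smooth f x
  exact isIntegral_of_irreducibleSpace_of_isReduced Y

variable [IsFinite π] [IsIntegral Y] [IsDominant π]

/-- **The chart subalgebras.** For `l ∈ {0, 1}` let `t_l = x_{l'}/x_l ∈ K(ℙ¹) ⊆ F = K(Y)`. The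
image `B_l` in `F` of `Γ(π⁻¹ D₊(x_l), 𝒪_Y)` is a `K`-subalgebra containing `t_l`, contained in every
valuation ring `𝒪_P ∋ t_l` of `F/K` (its elements are integral over `K[t_l]`, `π` being finite),
with fraction field `F` (`FunctionFieldOver.exists_mul_eq_ofPreimageSection`), and with reduced
Artinian fibre rings `B_l/(t_l - c)`, `c ∈ K` (`π` being finite étale: the fibre of
`Spec B_l → Spec K[t_l]` over `t_l = c`). [cite: SGA1, Exp. I Déf. 4.9] -/
theorem exists_chart_subalgebra [Algebra K (FunctionFieldOver π)]
    [IsScalarTower K (P 1 K).functionField (FunctionFieldOver π)] (l : Fin 2) :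
    ∃ (B : Subalgebra K (FunctionFieldOver π))
      (ht : algebraMap (P 1 K).functionField (FunctionFieldOver π)
        (awayToFunctionField (d := 1) (K := K) l (frac K l (l.succAbove 0))) ∈ B),
      (∀ v : PlaceOver K (FunctionFieldOver π),
        algebraMap (P 1 K).functionField (FunctionFieldOver π)
          (awayToFunctionField (d := 1) (K := K) l (frac K l (l.succAbove 0))) ∈ v.toValuationSubring →
        ∀ b ∈ B, b ∈ v.toValuationSubring) ∧
      (∀ f : FunctionFieldOver π, ∃ a ∈ B, ∃ b ∈ B, b ≠ 0 ∧ f * b = a) ∧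
      ∀ c : K, IsReduced (B ⧸ Ideal.span {(⟨_, sub_mem ht (B.algebraMap_mem c)⟩ : B)}) ∧
        IsArtinianRing (B ⧸ Ideal.span {(⟨_, sub_mem ht (B.algebraMap_mem c)⟩ : B)}) := by
  -- notation
  set F₀ := (P 1 K).functionField
  set F := FunctionFieldOver π
  set ι₀ : F₀ →+* F := algebraMap F₀ F with hι₀
  set τ : F₀ := awayToFunctionField (d := 1) (K := K) l (frac K l (l.succAbove 0)) with hτ
  set t : F := ι₀ τ with ht
  have hU : genericPoint (P 1 K) ∈ U l := genericPoint_mem_U l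
  have hUaff : IsAffineOpen (U (d := 1) (K := K) l) := by
    have e : U (d := 1) (K := K) l = Proj.basicOpen (grading (Fin 2) K) (X l) := Opens.ext (coe_U l)
    rw [e]
    exact Proj.isAffineOpen_basicOpen _ _ (X_mem K l) zero_lt_one
  set A := Γ(P 1 K, U l) with hA
  set B' := Γ(Y, π ⁻¹ᵁ U l) with hB'
  set φ : A →+* B' := (π.app (U l)).hom with hφ
  set ψ : B' →+* F := FunctionFieldOver.ofPreimageSection π hU with hψ
  have hψφ : ∀ a : A, ψ (φ a) = ι₀ (ofSection hU a) := fun a ↦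
    FunctionFieldOver.ofPreimageSection_app π hU a
  have hψinj : Function.Injective ψ := fun b₁ b₂ h ↦
    germ_injective_of_isIntegral _ (genericPoint Y) (genericPoint_mem_preimage π hU) h
  have halgK : ∀ c : K, algebraMap K F c = ι₀ (algebraMap K F₀ c) :=
    fun c ↦ IsScalarTower.algebraMap_apply K F₀ F c
  -- the polynomial formula: `ψ (φ (q(t_l))) = q(t)`
  have hpoly : ∀ q : Polynomial K, ψ (φ (sec l (polyChart[K, l] q))) =
      Polynomial.eval₂ (algebraMap K F) t q := by
    intro q
    rw [hψφ, show ofSection hU (sec l (polyChart[K, l] q)) =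
      awayToFunctionField (d := 1) (K := K) l (polyChart[K, l] q) from rfl,
      P1.awayToFunctionField_polyChart, Polynomial.hom_eval₂, ← hτ, ← ht]
    congr 1
    exact (IsScalarTower.algebraMap_eq K F₀ F).symm
  -- the subalgebra
  let B : Subalgebra K F :=
    { toSubsemiring := ψ.range.toSubsemiring
      algebraMap_mem' := fun c ↦ by
        refine ⟨φ (sec l (polyChart[K, l] (Polynomial.C c))), ?_⟩
        rw [hpoly, Polynomial.eval₂_C] }
  have hmemB : ∀ {x : F}, x ∈ B ↔ ∃ b : B', ψ b = x := fun {x} ↦ Iff.rfl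
  have htB : t ∈ B := by
    refine ⟨φ (sec l (polyChart[K, l] Polynomial.X)), ?_⟩
    rw [hpoly, Polynomial.eval₂_X]
  refine ⟨B, htB, ?_, ?_, ?_⟩
  · -- `B ⊆ 𝒪_P` whenever `t ∈ 𝒪_P`
    intro v htv b hb
    obtain ⟨σ, rfl⟩ := hmemB.1 hb
    have hcoef : ∀ a : A, (ψ.comp φ) a ∈ v.toValuationSubring := by
      intro a
      obtain ⟨q, rfl⟩ := P1.exists_sec_polyChart_eq K l a
      rw [RingHom.comp_apply, hpoly, Polynomial.eval₂_eq_sum_range]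
      refine Finset.sum_induction _ (· ∈ v.toValuationSubring) (fun _ _ ↦ add_mem) (zero_mem _)
        fun i _ ↦ ?_
      exact mul_mem (v.algebraMap_mem _) (pow_mem htv i)
    have hfin : φ.Finite := IsFinite.finite_app π (U l) hUaff
    obtain ⟨p, hpm, hp⟩ := hfin.to_isIntegral σ
    refine PlaceOver.mem_of_isIntegralElem v (ψ.comp φ) hcoef ⟨p, hpm, ?_⟩
    rw [← Polynomial.hom_eval₂, hp, map_zero]
  · -- `Frac B = F`
    intro f
    obtain ⟨b, a, ha0, hab⟩ := FunctionFieldOver.exists_mul_eq_ofPreimageSection π hUaff hU f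
    refine ⟨ψ b, ⟨b, rfl⟩, ψ (φ a), ⟨φ a, rfl⟩, ?_, ?_⟩
    · rw [hψφ]
      refine (map_ne_zero ι₀).2 fun h0 ↦ ha0 ?_
      exact germ_injective_of_isIntegral _ (genericPoint (P 1 K)) hU (by rw [map_zero]; exact h0)
    · rw [hψφ, mul_comm]
      exact hab
  · -- the fibre rings
    intro c
    set p₀ : Ideal (Polynomial K) := Ideal.span {Polynomial.X - Polynomial.C c} with hp₀
    haveI hp₀max : p₀.IsMaximal := isMaximal_span_X_sub_C K c
    let eA : Polynomial K ≃+* A :=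
      (polyChart[K, l]).toRingEquiv.trans (RingEquiv.ofBijective (secRingHom l) (sec_bijective l))
    have heA : ∀ q, eA q = sec l (polyChart[K, l] q) := fun q ↦ rfl
    set pA : Ideal A := p₀.map eA with hpA
    haveI hpAmax : pA.IsMaximal := Ideal.IsMaximal.map_bijective eA eA.bijective hp₀max
    have hpAspan : pA = Ideal.span {eA (Polynomial.X - Polynomial.C c)} := by
      rw [hpA, hp₀, Ideal.map_span, Set.image_singleton]
    -- `A → B'` is finite and formally unramified
    letI algAB : Algebra A B' := φ.toAlgebra
    haveI : Module.Finite A B' := IsFinite.finite_app π (U l) hUaff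
    have het : φ.Etale := by
      rw [hφ, Scheme.Hom.app_eq_appLE]
      exact HasRingHomProperty.appLE (P := @Etale) π inferInstance ⟨U l, hUaff⟩
        ⟨π ⁻¹ᵁ U l, hUaff.preimage π⟩ le_rfl
    haveI : Algebra.Etale A B' := het
    haveI : Algebra.FormallyUnramified A B' := inferInstance
    obtain ⟨hred, hart⟩ := isReduced_and_isArtinianRing_fibre (A := A) (B := B') pA
    -- transport along `B' ≅ B`
    let ψB : B' →+* B := ψ.codRestrict B fun b ↦ ⟨b, rfl⟩
    have hψB : Function.Bijective ψB := by
      refine ⟨fun b₁ b₂ h ↦ hψinj (congrArg Subtype.val h), ?_⟩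
      rintro ⟨x, b, rfl⟩
      exact ⟨b, rfl⟩
    let e₀ : B' ≃+* B := RingEquiv.ofBijective ψB hψB
    set J : Ideal B := Ideal.span {(⟨_, sub_mem htB (B.algebraMap_mem c)⟩ : B)} with hJ
    have hJmap : J = (pA.map (algebraMap A B')).map (e₀ : B' →+* B) := by
      rw [hpAspan, Ideal.map_span, Set.image_singleton, Ideal.map_span, Set.image_singleton, hJ]
      congr 2
      apply Subtype.ext
      change t - algebraMap K F c = ψ (φ (eA (Polynomial.X - Polynomial.C c)))
      rw [heA, hpoly, Polynomial.eval₂_sub, Polynomial.eval₂_X, Polynomial.eval₂_C]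
    let eQ : (B' ⧸ pA.map (algebraMap A B')) ≃+* (B ⧸ J) := Ideal.quotientEquiv _ _ e₀ hJmap
    haveI := hred
    haveI := hart
    exact ⟨isReduced_of_injective eQ.symm.toRingHom eQ.symm.injective,
      Function.Surjective.isArtinianRing (f := eQ.toRingHom) eQ.surjective⟩

/-- For equal points the (co)specialisation map of stalks is an isomorphism. [folklore] -/
theorem isIso_stalkSpecializes_of_eq {X : Scheme.{u}} {x y : X} (e : x = y) (h : x ⤳ y) :
    IsIso (X.presheaf.stalkSpecializes h) := by
  subst e
  rw [TopCat.Presheaf.stalkSpecializes_refl]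
  infer_instance

omit [IsIntegral Y] [IsDominant π] in
/-- **A connected finite étale cover of `ℙ¹` over an algebraically closed field is an
isomorphism** (SGA 1, XI 1.1 for `r = 1`): with `F = K(Y) ⊇ K(ℙ¹) = K(t)`, the two chart subalgebras
of `exists_chart_subalgebra` show that `t` is unramified at every place of the algebraic function
field `F/K`, so `F = K(t)` by the Riemann–Hurwitz formula
(`AlgFunctionField.adjoin_simple_eq_top_of_charts`: "`1 - g' = d(1 - g)` […] exige `d = 1`");
thus `K(ℙ¹) → K(Y)` is an isomorphism and the finite birational `π` onto the normal `ℙ¹` is an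
isomorphism (`Resolution.isIso_morphismRestrict_of_isIntegralHom_of_isIso_stalkMap`).
[cite: SGA1, Exp. XI Prop. 1.1 (r = 1)] -/
theorem isIso_of_isFinite_of_etale_projectiveLine [IsAlgClosed K] [ConnectedSpace Y] :
    IsIso π := by
  haveI : IsIntegral Y := isIntegral_of_connectedSpace π
  haveI : Surjective π :=
    @surjective_of_isFinite_of_etale_projectiveSpace K _ 1 Y π (by exact ‹IsFinite π›)
      (by exact ‹Etale π›) _
  -- the function fields
  set F₀ := (P 1 K).functionField with hF₀
  set F := FunctionFieldOver π with hF
  set ι₀ : F₀ →+* F := algebraMap F₀ F with hι₀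
  letI algKF : Algebra K F := (ι₀.comp (algebraMap K F₀)).toAlgebra
  haveI : IsScalarTower K F₀ F := IsScalarTower.of_algebraMap_eq fun _ ↦ rfl
  haveI : IsAlgFunctionField K F₀ := P1.isAlgFunctionField K
  haveI : IsAlgFunctionField K F :=
    isAlgFunctionField_of_finiteDimensional (K := K) (F := F₀) (F' := F)
  -- the coordinate `t = x₁/x₀` and its inverse `x₀/x₁`
  set τ₀ : F₀ := awayToFunctionField (d := 1) (K := K) 0 (frac K 0 1) with hτ₀
  set τ₁ : F₀ := awayToFunctionField (d := 1) (K := K) 1 (frac K 1 0) with hτ₁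
  set t : F := ι₀ τ₀ with ht
  have hτ01 : τ₀ * τ₁ = 1 := P1.coord_mul_coord_eq_one K
  have htinv : ι₀ τ₁ = t⁻¹ := by
    refine (inv_eq_of_mul_eq_one_right ?_).symm
    rw [ht, ← map_mul, hτ01, map_one]
  have httrans : Transcendental K t := by
    rw [ht, hι₀, transcendental_algebraMap_iff (algebraMap F₀ F).injective]
    exact P1.transcendental_coord K 0
  have htK : t ∉ Set.range (algebraMap K F) := by
    rintro ⟨c, hc⟩
    exact httrans (hc ▸ isAlgebraic_algebraMap c)
  -- the two charts (`(0 : Fin 2).succAbove 0 = 1`, `(1 : Fin 2).succAbove 0 = 0` by `rfl`)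
  obtain ⟨B₀, ht₀', h₀O', h₀frac, h₀fib⟩ := exists_chart_subalgebra π 0
  obtain ⟨B₁, ht₁', h₁O'', h₁frac, h₁fib⟩ := exists_chart_subalgebra π 1
  have ht₀ : t ∈ B₀ := ht₀'
  have h₀O : ∀ v : PlaceOver K F, t ∈ v.toValuationSubring → ∀ b ∈ B₀, b ∈ v.toValuationSubring :=
    h₀O'
  have h₁O : ∀ v : PlaceOver K F, ι₀ τ₁ ∈ v.toValuationSubring → ∀ b ∈ B₁, b ∈ v.toValuationSubring :=
    h₁O''
  have ht₁ : t⁻¹ ∈ B₁ := htinv ▸ (ht₁' : ι₀ τ₁ ∈ B₁)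
  have h₁O' : ∀ v : PlaceOver K F, t ∉ v.toValuationSubring → ∀ b ∈ B₁, b ∈ v.toValuationSubring := by
    intro v htv
    have : ι₀ τ₁ ∈ v.toValuationSubring := by
      rw [htinv]
      exact (v.toValuationSubring.mem_or_inv_mem t).resolve_left htv
    exact h₁O v this
  have h₀fib' : ∀ c : K,
      IsReduced (B₀ ⧸ Ideal.span {(⟨t - algebraMap K F c, sub_mem ht₀ (B₀.algebraMap_mem c)⟩ : B₀)}) ∧
      IsArtinianRing (B₀ ⧸ Ideal.span {(⟨t - algebraMap K F c, sub_mem ht₀ (B₀.algebraMap_mem c)⟩ : B₀)}) :=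
    h₀fib
  have h₁fib' : IsReduced (B₁ ⧸ Ideal.span {(⟨t⁻¹, ht₁⟩ : B₁)}) ∧
      IsArtinianRing (B₁ ⧸ Ideal.span {(⟨t⁻¹, ht₁⟩ : B₁)}) := by
    have hx : (⟨ι₀ τ₁ - algebraMap K F 0, sub_mem ht₁' (B₁.algebraMap_mem 0)⟩ : B₁) = ⟨t⁻¹, ht₁⟩ :=
      Subtype.ext (by change ι₀ τ₁ - algebraMap K F 0 = t⁻¹; rw [map_zero, sub_zero, htinv])
    exact (congrArg (fun x : B₁ ↦ IsReduced (B₁ ⧸ Ideal.span {x}) ∧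
      IsArtinianRing (B₁ ⧸ Ideal.span {x})) hx).mp (h₁fib 0)
  -- `F = K(t)`
  have htop : K⟮t⟯ = ⊤ :=
    adjoin_simple_eq_top_of_charts htK B₀ B₁ h₀O h₁O' h₀frac h₁frac ht₀ ht₁ h₀fib' h₁fib'
  -- `K(ℙ¹) → K(Y)` is bijective
  have hsurj : Function.Surjective ι₀ := by
    let ιA : F₀ →ₐ[K] F := { ι₀ with commutes' := fun _ ↦ rfl }
    have hle : (⊤ : IntermediateField K F) ≤ ιA.fieldRange := by
      rw [← htop, IntermediateField.adjoin_simple_le_iff]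
      exact ⟨τ₀, rfl⟩
    intro x
    obtain ⟨y, hy⟩ := hle (IntermediateField.mem_top (x := x))
    exact ⟨y, hy⟩
  have hstalk : IsIso (π.stalkMap (genericPoint Y)) := by
    haveI h1 : IsIso ((P 1 K).presheaf.stalkSpecializes (specializes_genericPoint π)) :=
      isIso_stalkSpecializes_of_eq (genericPoint_eq_of_isDominant π) _
    haveI h2 : IsIso ((P 1 K).presheaf.stalkSpecializes (specializes_genericPoint π) ≫
        π.stalkMap (genericPoint Y)) :=
      (ConcreteCategory.isIso_iff_bijective _).mpr ⟨ι₀.injective, hsurj⟩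
    exact IsIso.of_isIso_comp_left ((P 1 K).presheaf.stalkSpecializes (specializes_genericPoint π))
      (π.stalkMap (genericPoint Y))
  -- conclusion: `π` is finite birational onto the normal `ℙ¹`
  have hY : ∀ y : P 1 K, IsIntegrallyClosed ((P 1 K).presheaf.stalk y) :=
    P1.isIntegrallyClosed_stalk K
  have key : MorphismProperty.isomorphisms Scheme π := by
    refine (IsZariskiLocalAtTarget.iff_of_iSup_eq_top (P := MorphismProperty.isomorphisms Scheme) _
      (Resolution.iSup_nonempty_affineOpens_eq_top (P 1 K))).mpr ?_
    rintro ⟨V, hVne⟩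
    show IsIso (π ∣_ (V : (P 1 K).Opens))
    haveI := hVne
    exact Resolution.isIso_morphismRestrict_of_isIntegralHom_of_isIso_stalkMap π hY hstalk V
  exact key

end Cover

/-! ### The discharge -/

/-- **SGA 1, Exp. XI, Prop. 1.1 for `r = 1`: `ℙ¹` over an algebraically closed field is simply
connected** — every finite étale `π : Y → ℙ¹_k` with `Y` connected is an isomorphism. Discharge of
the named fact `ProjectiveLineSimplyConnected` (`FundamentalGroup/ProjectiveSpace.lean`) by the
printed genus argument, through the function field `k(Y) ⊇ k(t)`
(`isIso_of_isFinite_of_etale_projectiveLine`). [cite: SGA1, Exp. XI Prop. 1.1 (r = 1)] -/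
theorem ProjectiveLineSimplyConnected_holds : ProjectiveLineSimplyConnected.{u} := by
  intro k _ _ Y π hfin het hconn
  exact @isIso_of_isFinite_of_etale_projectiveLine k _ Y π het hfin _ hconn

end Literature.AlgebraicGeometry.FundamentalGroup

end
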